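import Literature.NumberTheory.Transcendental.TaylorCoeffIntegral
import Mathlib.NumberTheory.Chebyshev
import HarnessLib

/-!
# Nesterenko's elementary bricks, I: the polynomial brick and Zudilin's Lemma 15

Topic `Literature/NumberTheory/Transcendental`. The rational functions
`R(a,b;t) = (t+b)(t+b+1)⋯(t+a-1)/(a-b)!` (`a ≥ b`) and `(b-a-1)!/((t+a)(t+a+1)⋯(t+b-1))`
(`a < b`) are the "elementary bricks" of Nesterenko's construction of linear forms in zeta values
[Zudilin2004, §7, (7.3)]; every rational function of the hypergeometric constructions of
Ball–Rivoal–Zudilin is a product of bricks, and the arithmetic of the linear forms (denominators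
`D_N = lcm(1,…,N)` and the `p`-adic savings `Φ`) is read off brick by brick through the Leibniz
rule ([Zudilin2004, Lemmas 15–19]). This file treats the POLYNOMIAL brick:

* `polyBrick b m t = (t+b)(t+b+1)⋯(t+b+m-1)/m!` — Zudilin's `R(a,b;t)` for `a = b + m ≥ b`
  (an integer-valued polynomial of degree `m`);
* `polyBrick_pascal` — Pascal's rule `C(y, m+1) = C(y-1, m+1) + C(y-1, m)` in the form
  `polyBrick (c+1) (m+1) = polyBrick c (m+1) + polyBrick (c+1) m`;
* `polyBrick_isDInt` — **[Zudilin2004, Lemma 15]**: for every integer `k` and every `j`,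
  `D_m^j · (1/j!) (d/dt)^j polyBrick b m (k) ∈ ℤ` (`D_m = lcm(1,…,m) = Nat.lcmUpto m`), in the
  book-keeping form `IsDInt (Nat.lcmUpto m) N (polyBrick b m) k` of `TaylorCoeffIntegral.lean`.

Proof of Lemma 15 (a variant of the classical argument on integer-valued polynomials, arranged
to use only the product and sum rules for `IsDInt`): by translation it suffices to treat the
point `0` for all shifts `b`; for `b = -m'` (`m = m'+1`) one has the factorisation
`polyBrick (-m') (m'+1) t = (t/(m'+1)) ∏_{q=1}^{m'} (t/q - 1)`, each factor of which has value in
`ℤ` and first divided derivative `1/q` with `q ∣ D_m`, so the product rule applies; Pascal's rule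
then moves the shift `b` up and down through `ℤ` (induction on `m` for the lower-degree term).
Everything here is PROVED (no named facts).

## References

* [Zudilin2004] W. Zudilin, *Arithmetic of linear forms involving odd zeta values*, J. Théor.
  Nombres Bordeaux 16 (2004), 251–291, §7, (7.3) and Lemma 15 (citing [Zu5, Lemma 7] =
  Zudilin, *An elementary proof of Apéry's theorem*, 2002).
-/

noncomputable section

open Finset Filter Literature.Analysis.Calculus
open scoped Nat

namespace Literature.NumberTheory.Transcendental

/-! ### The polynomial brick -/

/-- **Nesterenko's polynomial brick** `polyBrick b m t = (t+b)(t+b+1)⋯(t+b+m-1) / m!`, i.e.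
Zudilin's `R(a,b;t) = (t+b)(t+b+1)⋯(t+a-1)/(a-b)!` for `a = b + m ≥ b` ([Zudilin2004, (7.3),
first case]); as a function of `t` it is the integer-valued polynomial `C(t+b+m-1, m)`.
[cite: Zudilin2004, §7 (7.3)] -/
def polyBrick (b : ℤ) (m : ℕ) (t : ℚ) : ℚ :=
  (∏ l ∈ range m, (t + b + l)) / (m ! : ℚ)

/-- `polyBrick b 0 = 1`. [folklore] -/
@[simp] theorem polyBrick_zero (b : ℤ) (t : ℚ) : polyBrick b 0 t = 1 := by
  simp [polyBrick]

/-- Translation of the variable: `polyBrick b m (t + k) = polyBrick (b + k) m t`. [folklore] -/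
theorem polyBrick_add_int (b : ℤ) (m : ℕ) (k : ℤ) (t : ℚ) :
    polyBrick b m (t + k) = polyBrick (b + k) m t := by
  unfold polyBrick
  congr 1
  refine prod_congr rfl fun l _ => ?_
  push_cast
  ring

/-- **Pascal's rule** for the polynomial brick:
`polyBrick (c+1) (m+1) = polyBrick c (m+1) + polyBrick (c+1) m`
(i.e. `C(y, m+1) = C(y-1, m+1) + C(y-1, m)` with `y = t + c + m + 1`). [folklore] -/
theorem polyBrick_pascal (c : ℤ) (m : ℕ) (t : ℚ) :
    polyBrick (c + 1) (m + 1) t = polyBrick c (m + 1) t + polyBrick (c + 1) m t := by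
  unfold polyBrick
  set P : ℚ := ∏ l ∈ range m, (t + ((c + 1 : ℤ) : ℚ) + l) with hP
  have h1 : ∏ l ∈ range (m + 1), (t + ((c + 1 : ℤ) : ℚ) + l) = P * (t + c + 1 + m) := by
    rw [prod_range_succ, hP]
    push_cast
    ring_nf
  have h2 : ∏ l ∈ range (m + 1), (t + ((c : ℤ) : ℚ) + l) = (t + c) * P := by
    rw [prod_range_succ', hP]
    have hl : ∀ l ∈ range m,
        (t + ((c : ℤ) : ℚ) + ((l + 1 : ℕ) : ℚ)) = (t + ((c + 1 : ℤ) : ℚ) + (l : ℚ)) := by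
      intro l _
      push_cast
      ring
    rw [prod_congr rfl hl]
    push_cast
    ring
  rw [h1, h2, Nat.factorial_succ]
  have hm : ((m ! : ℕ) : ℚ) ≠ 0 := by exact_mod_cast (Nat.factorial_pos m).ne'
  have hm1 : ((m + 1 : ℕ) : ℚ) ≠ 0 := by exact_mod_cast Nat.succ_ne_zero m
  push_cast
  field_simp
  ring

/-! ### Lemma 15 at the point `0` -/

/-- The base case `b = -m`, degree `m + 1`: the factorisation
`polyBrick (-m) (m+1) t = (t/(m+1)) · ∏_{l<m} (t/(m-l) - 1)` (`= C(t, m+1)`). [folklore] -/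
theorem polyBrick_neg_self_succ (m : ℕ) (t : ℚ) :
    polyBrick (-(m : ℤ)) (m + 1) t =
      (1 / ((m : ℚ) + 1) * t) * ∏ l ∈ range m, (1 / ((m : ℚ) - l) * t - 1) := by
  unfold polyBrick
  rw [prod_range_succ]
  have hfac : ∏ l ∈ range m, (t + ((-(m : ℤ) : ℤ) : ℚ) + l)
      = (∏ l ∈ range m, ((m : ℚ) - l)) * ∏ l ∈ range m, (1 / ((m : ℚ) - l) * t - 1) := by
    rw [← prod_mul_distrib]
    refine prod_congr rfl fun l hl => ?_
    have hl' : (l : ℚ) < m := by exact_mod_cast mem_range.1 hl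
    have hne : (m : ℚ) - l ≠ 0 := by linarith
    push_cast
    field_simp
    ring
  have hprod : ∏ l ∈ range m, ((m : ℚ) - l) = (m ! : ℚ) := by
    have h := prod_range_reflect (fun j : ℕ => ((j : ℚ) + 1)) m
    rw [← prod_range_add_one_eq_factorial, Nat.cast_prod]
    push_cast
    rw [← h]
    refine prod_congr rfl fun l hl => ?_
    have hl' := mem_range.1 hl
    rw [Nat.cast_sub (by omega), Nat.cast_sub (by omega)]
    push_cast
    ring
  rw [hfac, hprod, Nat.factorial_succ]
  have hm : ((m ! : ℕ) : ℚ) ≠ 0 := by exact_mod_cast (Nat.factorial_pos m).ne'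
  have hm1 : ((m : ℚ) + 1) ≠ 0 := by exact_mod_cast Nat.succ_ne_zero m
  push_cast
  field_simp
  ring

/-- `l ∣ D_m` for `1 ≤ l ≤ m`. [folklore] -/
theorem dvd_lcmUpto {l m : ℕ} (h1 : 1 ≤ l) (h2 : l ≤ m) : l ∣ Nat.lcmUpto m := by
  unfold Nat.lcmUpto
  exact Finset.dvd_lcm (mem_Icc.2 ⟨h1, h2⟩)

/-- `D_m ∣ D_{m'}` for `m ≤ m'`. [folklore] -/
theorem lcmUpto_dvd_lcmUpto {m m' : ℕ} (h : m ≤ m') : Nat.lcmUpto m ∣ Nat.lcmUpto m' := by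
  unfold Nat.lcmUpto
  exact Finset.lcm_mono (Icc_subset_Icc le_rfl h)

/-- The base case of Lemma 15: `IsDInt D_{m+1} N (polyBrick (-m) (m+1)) 0`, by the product rule
applied to the factorisation `polyBrick_neg_self_succ`. [cite: Zudilin2004, §7 Lemma 15] -/
theorem polyBrick_neg_self_succ_isDInt (m N : ℕ) :
    IsDInt (Nat.lcmUpto (m + 1)) N (polyBrick (-(m : ℤ)) (m + 1)) 0 := by
  have hlin : IsDInt (Nat.lcmUpto (m + 1)) N (fun t : ℚ => 1 / ((m : ℚ) + 1) * t + 0) 0 := by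
    refine IsDInt.affine _ _ ⟨0, by simp⟩ ?_
    obtain ⟨c, hc⟩ := dvd_lcmUpto (l := m + 1) (m := m + 1) (by omega) le_rfl
    refine ⟨c, ?_⟩
    rw [hc]
    have : ((m : ℚ) + 1) ≠ 0 := by exact_mod_cast Nat.succ_ne_zero m
    push_cast
    field_simp
  have hfac : ∀ l ∈ range m,
      IsDInt (Nat.lcmUpto (m + 1)) N (fun t : ℚ => 1 / ((m : ℚ) - l) * t + (-1)) 0 := by
    intro l hl
    have hl' := mem_range.1 hl
    refine IsDInt.affine _ _ ⟨-1, by simp⟩ ?_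
    obtain ⟨c, hc⟩ := dvd_lcmUpto (l := m - l) (m := m + 1) (by omega) (by omega)
    refine ⟨c, ?_⟩
    rw [hc]
    have hne : ((m : ℚ) - l) ≠ 0 := by
      have : (l : ℚ) < m := by exact_mod_cast hl'
      linarith
    push_cast
    rw [Nat.cast_sub hl'.le]
    field_simp
  have hprod := (hlin.mul (IsDInt.prod (range m) hfac))
  refine hprod.congr (Eventually.of_forall fun t => ?_)
  rw [polyBrick_neg_self_succ]
  simp only [add_zero]
  congr 1
  exact prod_congr rfl fun l _ => by ring

/-- Lemma 15 at the point `0`, for every shift `c`: induction on the degree `m`, and for fixed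
`m` on the shift through `ℤ` by Pascal's rule, starting from `c = 1 - m`.
[cite: Zudilin2004, §7 Lemma 15] -/
theorem polyBrick_isDInt_zero (m : ℕ) : ∀ (c : ℤ) (N : ℕ),
    IsDInt (Nat.lcmUpto m) N (polyBrick c m) 0 := by
  induction m with
  | zero =>
    intro c N
    exact (IsDInt.one (Nat.lcmUpto 0) N 0).congr (Eventually.of_forall fun t => by simp)
  | succ m ih =>
    intro c N
    have ih' : ∀ c' : ℤ, IsDInt (Nat.lcmUpto (m + 1)) N (polyBrick c' m) 0 := fun c' =>
      (ih c' N).of_dvd (lcmUpto_dvd_lcmUpto (Nat.le_succ m))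
    suffices H : ∀ i : ℤ, IsDInt (Nat.lcmUpto (m + 1)) N (polyBrick (-(m : ℤ) + i) (m + 1)) 0 by
      have := H (c + m)
      rwa [show (-(m : ℤ) + (c + m)) = c by ring] at this
    intro i
    induction i using Int.induction_on with
    | zero => simpa using polyBrick_neg_self_succ_isDInt m N
    | succ i hi =>
      have hsum := hi.add (ih' (-(m : ℤ) + i + 1))
      rw [show (-(m : ℤ) + ((i : ℤ) + 1)) = (-(m : ℤ) + i) + 1 by ring]
      refine hsum.congr (Eventually.of_forall fun t => ?_)
      rw [polyBrick_pascal]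
    | pred i hi =>
      have hdiff := hi.sub (ih' (-(m : ℤ) + -(i : ℤ)))
      have e : (-(m : ℤ) + -(i : ℤ)) = (-(m : ℤ) + (-(i : ℤ) - 1)) + 1 := by ring
      refine hdiff.congr (Eventually.of_forall fun t => ?_)
      rw [e]
      beta_reduce
      rw [polyBrick_pascal]
      ring

/-! ### Lemma 15 -/

/-- **[Zudilin2004, Lemma 15]** (arithmetic of the polynomial brick; "well-known properties of
integer-valued polynomials"): for `R(t) = (t+b)(t+b+1)⋯(t+b+m-1)/m!` (Zudilin's `R(a,b;t)`,
`a = b + m ≥ b`), every integer point `k` and every `j ≥ 0`,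
`D_m^j · (1/j!) R^{(j)}(k) ∈ ℤ`, where `D_m = lcm(1, …, m)`. Stated as
`IsDInt (Nat.lcmUpto m) N (polyBrick b m) k` for every `N`. (Zudilin evaluates at `t = -k`,
`k ∈ ℤ`, which is the same statement.) [cite: Zudilin2004, §7 Lemma 15] -/
theorem polyBrick_isDInt (b : ℤ) (m : ℕ) (k : ℤ) (N : ℕ) :
    IsDInt (Nat.lcmUpto m) N (polyBrick b m) k := by
  refine IsDInt.of_comp_add ?_
  have h := polyBrick_isDInt_zero m (b + k) N
  refine h.congr (Eventually.of_forall fun t => ?_)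
  show polyBrick (b + k) m t = polyBrick b m (t + k)
  rw [polyBrick_add_int]

/-- Lemma 15 at the point `-k`, literally as printed: `D_{a-b}^j · (1/j!) R^{(j)}(-k) ∈ ℤ`.
[cite: Zudilin2004, §7 Lemma 15] -/
theorem polyBrick_isDInt_neg (b : ℤ) (m : ℕ) (k : ℤ) (N : ℕ) :
    IsDInt (Nat.lcmUpto m) N (polyBrick b m) (-(k : ℚ)) := by
  simpa using polyBrick_isDInt b m (-k) N

end Literature.NumberTheory.Transcendental
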